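import Summits.ResolutionOfSingularities.ResolutionOfSingularities.Theorems.ValuativeLuAlphaPTorsorCornerSuccessor
import Summits.ResolutionOfSingularities.ResolutionOfSingularities.Theorems.ValuativeLuAlphaPTorsorCornerStepState

/-!
# Giraud's free step at a corner successor: the colength of the finite part does not increase

Helper file for the stub `giraud_free_step_corner` (FS-C: Giraud 1983, Lemme 2.3 (ii) / §2.5,
the FREE step when the next centre is the CORNER) of the line `pfaff-line-log-final-forms`
(crux `Valuative.LuAlphaPTorsor`, item `stmt-ResolutionOfSingularities-0641`).

Setting: `R ⊆ K` a two-dimensional regular local ring dominated by the valuation ring `O`, `R₁`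
its quadratic transform along `O`, `u = (u 0, u 1)` a regular system of parameters of `R`, and
`x := u i₀` NOT of minimal value in `𝔪`; then `y := u (i₀ + 1)` has minimal value, `ν(x/y) > 0`,
`R₁ = (R[x/y])_Q` with `Q = 𝔪_O ∩ R[x/y] = (y, x/y)` (the corner of the `y`-chart), and the new
boundary `u' = (x/y, y)` is full. In the free step the log-content for the boundary `{x}` is
`C_x(f) = xᵃ · D₀` (`D₀` of finite colength, `D₀ ≠ R`); with `D₁ = (C_{x,y}(f) : xᵃ)` and
`D_y f = xᵃ B` one has `y D₀ ⊆ D₁ ⊆ D₀ = D₁ + (B)` (`content_bookkeeping_freeStepCorner`). The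
log-content of `f` in `R₁` for the full boundary `u'` is the total transform `C_{x,y}(f) R₁`
(`content_quadraticTransform_origin`), `= xᵃ · D₁ R₁ = (x/y)ᵃ yᵃ⁺ʳ · H'` with
`λ(R₁/H') ≤ λ(R/D₀)` (`corner_successor_colength`).

References: J. Giraud, *Forme normale d'une fonction sur une surface de caractéristique
positive*, Bull. SMF 111 (1983), Lemme 2.3 (ii), §2.5.
-/

set_option linter.dupNamespace false

noncomputable section

open IsLocalRing Literature.AlgebraicGeometry.Resolution

namespace Summit.ResolutionOfSingularities.ResolutionOfSingularities.Theorems.PfaffLine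

section FreeStepCorner

/-- In `Fin 2`, `a + 1 ≠ a`. [folklore] -/
theorem add_one_ne_fin_two_freeStepCorner : ∀ a : Fin 2, a + 1 ≠ a := by decide

/-- **Ultrametric bound on an ideal.** For `R ⊆ O` and a set `S ⊆ R` of elements of value at
most `ν(w)`, every element of the ideal `(S)` has value at most `ν(w)`. [folklore] -/
theorem valuation_le_of_mem_span_freeStepCorner {K : Type*} [Field K] (O : ValuationSubring K)
    {R : Subring K} (hRO : R ≤ O.toSubring) (w : K) {S : Set R}
    (hS : ∀ s ∈ S, O.valuation ((s : R) : K) ≤ O.valuation w) :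
    ∀ z ∈ Ideal.span S, O.valuation ((z : R) : K) ≤ O.valuation w := by
  intro z hz
  induction hz using Submodule.span_induction with
  | mem s hs => exact hS s hs
  | zero => simp
  | add s t _ _ hs ht =>
    rw [Subring.coe_add]
    exact (Valuation.map_add _ _ _).trans (max_le hs ht)
  | smul c s _ hs =>
    rw [smul_eq_mul, Subring.coe_mul, map_mul]
    calc O.valuation ((c : R) : K) * O.valuation ((s : R) : K) ≤ 1 * O.valuation w :=
          mul_le_mul' ((O.valuation_le_one_iff _).mpr (hRO c.2)) hs
      _ = O.valuation w := one_mul _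

/-- **Bookkeeping of the free step** (Giraud 1983, §2.5). In a domain `R` with `u = (x, y)`
(`x = u i₀ ≠ 0`, `y = u (i₀ + 1)`), a `ℤ`-derivation `D_y` with `D_y x = 0`, `D_y y = 1`, and
`C_x(f) = xᵃ · D₀` for the log-content `C_x(f) = ({x}-logarithmic δ) f`: the full log-content
`C_{x,y}(f)` is `xᵃ · D₁` with `D₁ ⊆ D₀`, `y D₀ ⊆ D₁` and `D₀ = D₁ + (B)` where `D_y f = xᵃ B`.
Indeed `C_{x,y} ⊆ C_x`, `y C_x ⊆ C_{x,y}` (`y δ` is everywhere logarithmic) and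
`C_x = C_{x,y} + (D_y f)` (`δ - δ(y) D_y` is everywhere logarithmic); cancel `xᵃ`. [folklore] -/
theorem content_bookkeeping_freeStepCorner {R : Type*} [CommRing R] [IsDomain R] (u : Fin 2 → R)
    (i₀ : Fin 2) (Dy : Derivation ℤ R R) (hDyx : Dy (u i₀) = 0) (hDyy : Dy (u (i₀ + 1)) = 1)
    (hx0 : u i₀ ≠ 0) (f : R) (a : ℕ) (D₀ : Ideal R)
    (hJ : Ideal.span {b | ∃ δ : Derivation ℤ R R,
        (∀ i ∈ ({i₀} : Finset (Fin 2)), δ (u i) ∈ Ideal.span {u i}) ∧ δ f = b} =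
      Ideal.span {u i₀ ^ a} * D₀) :
    ∃ (D₁ : Ideal R) (B : R),
      Ideal.span {b | ∃ δ : Derivation ℤ R R,
          (∀ i ∈ (Finset.univ : Finset (Fin 2)), δ (u i) ∈ Ideal.span {u i}) ∧ δ f = b} =
        Ideal.span {u i₀ ^ a} * D₁ ∧
      D₁ ≤ D₀ ∧ Ideal.span {u (i₀ + 1)} * D₀ ≤ D₁ ∧ D₀ = D₁ ⊔ Ideal.span {B} := by
  classical
  set Cx := Ideal.span {b | ∃ δ : Derivation ℤ R R,
      (∀ i ∈ ({i₀} : Finset (Fin 2)), δ (u i) ∈ Ideal.span {u i}) ∧ δ f = b} with hCxdef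
  set Cxy := Ideal.span {b | ∃ δ : Derivation ℤ R R,
      (∀ i ∈ (Finset.univ : Finset (Fin 2)), δ (u i) ∈ Ideal.span {u i}) ∧ δ f = b} with hCxydef
  -- `C_{x,y} ⊆ C_x`
  have hle1 : Cxy ≤ Cx :=
    Ideal.span_mono fun b ⟨δ, hδ, hb⟩ => ⟨δ, fun i _ => hδ i (Finset.mem_univ i), hb⟩
  -- `y C_x ⊆ C_{x,y}`
  have hle2 : Ideal.span {u (i₀ + 1)} * Cx ≤ Cxy := by
    rw [hCxdef, Ideal.span_mul_span', Set.singleton_mul, Ideal.span_le]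
    rintro _ ⟨b, ⟨δ, hδ, rfl⟩, rfl⟩
    refine Ideal.subset_span ⟨u (i₀ + 1) • δ, fun i _ => ?_,
      by rw [Derivation.smul_apply, smul_eq_mul]⟩
    rw [Derivation.smul_apply, smul_eq_mul]
    rcases fin_two_eq_or_eq_add_one_cornerStep i₀ i with rfl | rfl
    · exact Ideal.mul_mem_left _ _ (hδ _ (Finset.mem_singleton_self _))
    · exact Ideal.mul_mem_right _ _ (Ideal.mem_span_singleton_self _)
  -- `C_x = C_{x,y} + (D_y f)`
  have hDyf : Dy f ∈ Cx := Ideal.subset_span ⟨Dy, fun i hi => by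
    rw [Finset.mem_singleton.mp hi, hDyx]; exact zero_mem _, rfl⟩
  have heq3 : Cx = Cxy ⊔ Ideal.span {Dy f} := by
    refine le_antisymm ?_ (sup_le hle1 ((Ideal.span_singleton_le_iff_mem _).mpr hDyf))
    rw [hCxdef, Ideal.span_le]
    rintro _ ⟨δ, hδ, rfl⟩
    have e : δ f = (δ - δ (u (i₀ + 1)) • Dy) f + δ (u (i₀ + 1)) * Dy f := by
      rw [Derivation.sub_apply, Derivation.smul_apply, smul_eq_mul]; ring
    rw [SetLike.mem_coe, e]
    refine add_mem (Ideal.mem_sup_left (Ideal.subset_span ⟨δ - δ (u (i₀ + 1)) • Dy,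
      fun i _ => ?_, rfl⟩)) (Ideal.mem_sup_right (Ideal.mem_span_singleton'.mpr ⟨_, rfl⟩))
    rw [Derivation.sub_apply, Derivation.smul_apply, smul_eq_mul]
    rcases fin_two_eq_or_eq_add_one_cornerStep i₀ i with rfl | rfl
    · rw [hDyx, mul_zero, sub_zero]; exact hδ _ (Finset.mem_singleton_self _)
    · rw [hDyy, mul_one, sub_self]; exact zero_mem _
  -- `D₁ = (C_{x,y} : xᵃ)` and `B` with `D_y f = xᵃ B`
  have hCxle : Cx ≤ Ideal.span {u i₀ ^ a} := by rw [hJ]; exact Ideal.mul_le_right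
  set D₁ : Ideal R := Cxy.colon ({u i₀ ^ a} : Set R) with hD₁def
  have hCxyeq : Cxy = Ideal.span {u i₀ ^ a} * D₁ :=
    eq_span_singleton_mul_colon (hle1.trans hCxle)
  obtain ⟨B, hB⟩ := Ideal.mem_span_singleton'.mp (hCxle hDyf)
  have hxa0 : u i₀ ^ a ≠ 0 := pow_ne_zero a hx0
  have hcancel : ∀ (D : Ideal R) (z : R), u i₀ ^ a * z ∈ Ideal.span {u i₀ ^ a} * D → z ∈ D := by
    intro D z hz
    obtain ⟨d, hd, e⟩ := Ideal.mem_span_singleton_mul.mp hz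
    rwa [← mul_left_cancel₀ hxa0 e]
  have h1 : D₁ ≤ D₀ := fun z hz => by
    refine hcancel D₀ z ?_
    rw [← hJ, mul_comm (u i₀ ^ a) z]
    exact hle1 (by simpa only [hD₁def, Submodule.mem_colon_singleton, smul_eq_mul] using hz)
  have h2 : Ideal.span {u (i₀ + 1)} * D₀ ≤ D₁ := by
    rw [Ideal.span_singleton_mul_le_iff]
    intro z hz
    rw [hD₁def, Submodule.mem_colon_singleton, smul_eq_mul, mul_assoc]
    refine hle2 (Ideal.mul_mem_mul (Ideal.mem_span_singleton_self _) ?_)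
    rw [hJ, mul_comm z]
    exact Ideal.mul_mem_mul (Ideal.mem_span_singleton_self _) hz
  have hBD0 : B ∈ D₀ := hcancel D₀ B (by rw [← hJ, mul_comm (u i₀ ^ a) B, hB]; exact hDyf)
  have h3 : D₀ = D₁ ⊔ Ideal.span {B} := by
    refine le_antisymm (fun z hz => ?_)
      (sup_le h1 ((Ideal.span_singleton_le_iff_mem _).mpr hBD0))
    have hz' : u i₀ ^ a * z ∈ Cx := by
      rw [hJ]; exact Ideal.mul_mem_mul (Ideal.mem_span_singleton_self _) hz
    rw [heq3, hCxyeq] at hz'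
    obtain ⟨c, hc, d, hd, hcd⟩ := Submodule.mem_sup.mp hz'
    obtain ⟨c', hc', rfl⟩ := Ideal.mem_span_singleton_mul.mp hc
    obtain ⟨e, rfl⟩ := Ideal.mem_span_singleton'.mp hd
    rw [← hB] at hcd
    have hz2 : z = c' + e * B := mul_left_cancel₀ hxa0 (by rw [← hcd]; ring)
    rw [hz2]
    exact add_mem (Ideal.mem_sup_left hc')
      (Ideal.mem_sup_right (Ideal.mem_span_singleton'.mpr ⟨e, rfl⟩))
  exact ⟨D₁, B, hCxyeq, h1, h2, h3⟩

end FreeStepCorner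

open IsLocalRing

/-- **Registered stub `giraud_free_step_corner`** (FS-C: Giraud 1983, Lemme 2.3 (ii) / §2.5, the
free step when the next centre is the corner). At a point of the two-dimensional regular local
ring `R ⊆ K` dominated by `O` with regular parameters `u` and boundary `{x}`, `x = u i₀` NOT of
minimal value, and log-content `C_x(f) = xᵃ · D₀` (`D₀` of finite colength, `D₀ ≠ R`): the
quadratic transform `R₁` along `O` is the local ring of the chart `R[x/y]` of the minimal-value
parameter `y = u (i₀ + 1)` at the corner `(y, x/y)` (`ν(x) < ν(y)`), the new boundary
`u₁ = (x/y, y)` is full with `(u₁) = 𝔪_{R₁}` (`eq_span_pair_of_mem_cornerStepState`), and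
the log-content of `f` in `R₁` is `C_{x,y}(f) R₁ = xᵃ D₁ R₁ = (x/y)ᵃ yᵃ⁺ʳ · J₀'`
(`content_quadraticTransform_origin`, `content_bookkeeping_freeStepCorner`,
`corner_successor_colength`) with `λ(R₁/J₀') ≤ λ(R/D₀)`. [folklore] -/
theorem giraud_free_step_corner : ∀ {K : Type} [Field K] (O : ValuationSubring K) (R R₁ : Subring K) [IsRegularLocalRing R] [IsLocalRing R₁] (h : Literature.AlgebraicGeometry.Resolution.IsQuadraticTransformAlong O R R₁), ringKrullDim R = 2 → Literature.AlgebraicGeometry.Resolution.SubringDominates R O.toSubring → (∀ (N : Type) [CommRing N] (ψ : R →+* N) (δ₀ : R →+ N), (∀ a b, δ₀ (a * b) = ψ a * δ₀ b + ψ b * δ₀ a) → ∀ Y : Finset R, ∃ (m : ℕ) (Δ : Fin m → Derivation ℤ R R) (nn : Fin m → N), ∀ y ∈ Y, δ₀ y = Finset.univ.sum fun j => ψ (Δ j y) * nn j) → (∀ (v : Fin 2 → R), Ideal.span (Set.range v) = maximalIdeal R → ∃ D : Fin 2 → Derivation ℤ R R, ∀ i j, D i (v j) = if i = j then 1 else 0)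 → ∀ (u : Fin 2 → R), Ideal.span (Set.range u) = maximalIdeal R → ∀ (i₀ : Fin 2), (¬ ∀ z ∈ maximalIdeal R, O.valuation (z : K) ≤ O.valuation ((u i₀ : R) : K)) → ∀ (f : R) (a : ℕ) (D₀ : Ideal R), Ideal.span {b | ∃ δ : Derivation ℤ R R, (∀ i ∈ ({i₀} : Finset (Fin 2)), δ (u i) ∈ Ideal.span {u i}) ∧ δ f = b} = Ideal.span {u i₀ ^ a} * D₀ → IsFiniteLength R (R ⧸ D₀) → D₀ ≠ ⊤ → ∃ (u₁ : Fin 2 → R₁) (N : Fin 2 → ℕ) (J₀' : Ideal R₁), Ideal.span (Set.range u₁) = maximalIdeal R₁ ∧ Ideal.span {b | ∃ δ' : Derivation ℤ R₁ R₁, (∀ i ∈ (Finset.univ : Finset (Fin 2)), δ' (u₁ i) ∈ Ideal.span {u₁ i}) ∧ δ' (Subring.inclusion h.le f) = b} = Ideal.span {Finset.univ.prod fun i => u₁ i ^ N i} * J₀' ∧ IsFiniteLength R₁ (R₁ ⧸ J₀') ∧ Module.length R₁ (R₁ ⧸ J₀') ≤ Module.length R (R ⧸ D₀) := by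
  intro K _ O R R₁ _ _ h hdim hdom hrich hdual u hspan i₀ hnot f a D₀ hJ hfin hD0top
  classical
  -- `x = u i₀`, `y = u (i₀ + 1)`; dual derivations; `x, y ≠ 0`
  obtain ⟨D, hD⟩ := hdual u hspan
  have hRO : R ≤ O.toSubring := hdom.1
  have hum : ∀ j, u j ∈ maximalIdeal R := fun j =>
    hspan ▸ Ideal.subset_span (Set.mem_range_self j)
  have hne0 : ∀ j, u j ≠ 0 := fun j h0 => by
    have h1 := hD j j
    rw [if_pos rfl, h0, map_zero] at h1
    exact zero_ne_one h1
  have hne : i₀ + 1 ≠ i₀ := add_one_ne_fin_two_freeStepCorner i₀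
  have hm : maximalIdeal R = Ideal.span {u i₀, u (i₀ + 1)} := by
    rw [← hspan, range_eq_pair_cornerStepState u i₀]
  have hm' : maximalIdeal R = Ideal.span {u (i₀ + 1), u i₀} := by rw [hm, Ideal.span_pair_comm]
  have hy0 : u (i₀ + 1) ≠ 0 := hne0 _
  have hy0K : ((u (i₀ + 1) : R) : K) ≠ 0 := fun e => hy0 (Subtype.ext e)
  -- valuations: `ν(x) < ν(y)`, `y` has minimal value, `x/y ∈ 𝔪_O`
  have hval : ∀ w : K, (∀ j, O.valuation ((u j : R) : K) ≤ O.valuation w) →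
      ∀ z ∈ maximalIdeal R, O.valuation (z : K) ≤ O.valuation w := by
    intro w hw z hz
    rw [← hspan] at hz
    exact valuation_le_of_mem_span_freeStepCorner O hRO w (by rintro _ ⟨j, rfl⟩; exact hw j) z hz
  have hlt : O.valuation ((u i₀ : R) : K) < O.valuation ((u (i₀ + 1) : R) : K) := by
    by_contra hge
    rw [not_lt] at hge
    refine hnot (hval _ fun j => ?_)
    rcases fin_two_eq_or_eq_add_one_cornerStep i₀ j with rfl | rfl
    exacts [le_rfl, hge]
  have hmin : ∀ z ∈ maximalIdeal R, O.valuation (z : K) ≤ O.valuation ((u (i₀ + 1) : R) : K) := by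
    refine hval _ fun j => ?_
    rcases fin_two_eq_or_eq_add_one_cornerStep i₀ j with rfl | rfl
    exacts [hlt.le, le_rfl]
  have hvy : O.valuation ((u (i₀ + 1) : R) : K) < 1 :=
    ((subringDominates_valuationSubring_iff hRO).mp hdom _).mp (hum _)
  have hvxy : O.valuation (((u i₀ : R) : K) / ((u (i₀ + 1) : R) : K)) < 1 := by
    rw [map_div₀, div_lt_one₀ (pos_iff_ne_zero.mpr ((map_ne_zero _).mpr hy0K))]
    exact hlt
  -- the chart `A = R[x/y] ⊆ O` and `R₁ = A_Q`, `Q = 𝔪_O ∩ A`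
  have hxyO : ((u i₀ : R) : K) / ((u (i₀ + 1) : R) : K) ∈ O.toSubring := by
    change _ ∈ O
    rw [← O.valuation_le_one_iff]
    exact hvxy.le
  have hAO : chartAdjoin (K := K) (u (i₀ + 1)) (u i₀) ≤ O.toSubring := adjoin_toSubring_le hRO hxyO
  have hA : blowupRing R ((u (i₀ + 1) : R) : K) = chartAdjoin (K := K) (u (i₀ + 1)) (u i₀) :=
    blowupRing_eq_adjoin hm'
  have hR₁T : R₁ = (LocalSubring.ofPrime (chartAdjoin (K := K) (u (i₀ + 1)) (u i₀))
      (subringCentre (chartAdjoin (K := K) (u (i₀ + 1)) (u i₀)) O hAO)).toSubring := by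
    rw [eq_locAtCentre_blowupRing_cornerStep O R R₁ h hRO u hspan (i₀ + 1) hy0 hmin, hA]
    exact locAtCentre_eq_ofPrime hAO
  subst hR₁T
  set Q : Ideal (chartAdjoin (K := K) (u (i₀ + 1)) (u i₀)) :=
    subringCentre (chartAdjoin (K := K) (u (i₀ + 1)) (u i₀)) O hAO with hQdef
  set T : Subring K := (LocalSubring.ofPrime (chartAdjoin (K := K) (u (i₀ + 1)) (u i₀)) Q).toSubring
    with hTdef
  set aT : chartAdjoin (K := K) (u (i₀ + 1)) (u i₀) →+* T :=
    algebraMap (chartAdjoin (K := K) (u (i₀ + 1)) (u i₀)) T with haTdef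
  have hAT : chartAdjoin (K := K) (u (i₀ + 1)) (u i₀) ≤ T := LocalSubring.le_ofPrime _ Q
  set sA : chartAdjoin (K := K) (u (i₀ + 1)) (u i₀) :=
    ⟨((u i₀ : R) : K) / ((u (i₀ + 1) : R) : K), Algebra.self_mem_adjoin_singleton R _⟩
    with hsAdef
  -- `Q = (y, x/y)`
  have hyQ : chartIncl (K := K) (u (i₀ + 1)) (u i₀) (u (i₀ + 1)) ∈ Q :=
    (mem_subringCentre_iff hAO _).mpr hvy
  have hsQ : sA ∈ Q := (mem_subringCentre_iff hAO _).mpr hvxy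
  have hQtop : Q ≠ ⊤ := (subringCentre.isPrime _ O hAO).ne_top
  have hQeq := eq_span_pair_of_mem_cornerStepState hm' hy0 hQtop hyQ hsQ
  -- the new coordinates `u' (i₀ + 1) = y`, `u' i₀ = x/y`
  have hyT : ((u (i₀ + 1) : R) : K) ∈ T := h.le (u (i₀ + 1)).2
  have hdivT : ∀ j, ((u j : R) : K) / ((u (i₀ + 1) : R) : K) ∈ T := fun j =>
    hAT (hA ▸ div_mem_blowupRing ((u (i₀ + 1) : R) : K) (hum j))
  set u' : Fin 2 → T := fun j =>
    if j = i₀ + 1 then ⟨((u (i₀ + 1) : R) : K), hyT⟩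
      else ⟨((u j : R) : K) / ((u (i₀ + 1) : R) : K), hdivT j⟩ with hu'
  have hy' : ((u' (i₀ + 1) : T) : K) = ((u (i₀ + 1) : R) : K) := by simp [hu']
  have hj' : ∀ j, j ≠ i₀ + 1 → ((u' j : T) : K) = ((u j : R) : K) / ((u (i₀ + 1) : R) : K) := by
    intro j hj
    simp [hu', hj]
  have hu'x : u' i₀ = aT sA := Subtype.ext (by rw [hj' i₀ hne.symm]; rfl)
  have hu'y : u' (i₀ + 1) = aT (chartIncl (K := K) (u (i₀ + 1)) (u i₀) (u (i₀ + 1))) :=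
    Subtype.ext (by rw [hy']; rfl)
  have hφx : Subring.inclusion h.le (u i₀) = u' i₀ * u' (i₀ + 1) := Subtype.ext (by
    rw [Subring.coe_mul, hj' i₀ hne.symm, hy', Subring.coe_inclusion]
    exact (div_mul_cancel₀ _ hy0K).symm)
  have hφy : Subring.inclusion h.le (u (i₀ + 1)) = u' (i₀ + 1) := Subtype.ext (by
    rw [hy', Subring.coe_inclusion])
  -- the content is the total transform (T5) of `C_{x,y}(f) = xᵃ D₁`
  have hC := content_quadraticTransform_origin O R T h hrich u D hD hspan (i₀ + 1) hy0K u' hy' hj' f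
  have hDyx : D (i₀ + 1) (u i₀) = 0 := by rw [hD, if_neg hne]
  have hDyy : D (i₀ + 1) (u (i₀ + 1)) = 1 := by rw [hD, if_pos rfl]
  obtain ⟨D₁, B, hCxy, h1, h2, h3⟩ :=
    content_bookkeeping_freeStepCorner u i₀ (D (i₀ + 1)) hDyx hDyy (hne0 i₀) f a D₀ hJ
  -- the corner successor (F2y): `D₁ T = yʳ H'`, `λ(T/H') ≤ λ(R/D₀)`
  obtain ⟨r, H', hD1map, hH'fin, hH'len⟩ :=
    corner_successor_colength hdim hm hy0 D₁ D₀ B h1 h2 h3 hfin hD0top Q hyQ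
  have hcomp : Subring.inclusion h.le = aT.comp (chartIncl (K := K) (u (i₀ + 1)) (u i₀)) :=
    RingHom.ext fun _ => Subtype.ext rfl
  have hD1map' : D₁.map (Subring.inclusion h.le) =
      Ideal.span {Subring.inclusion h.le (u (i₀ + 1)) ^ r} * H' := by
    rw [hcomp]; exact hD1map
  -- exponents `N i₀ = a`, `N (i₀ + 1) = a + r`
  set N : Fin 2 → ℕ := fun j => if j = i₀ + 1 then a + r else a with hNdef
  have hNx : N i₀ = a := if_neg hne.symm
  have hNy : N (i₀ + 1) = a + r := if_pos rfl
  have hgen : Subring.inclusion h.le (u i₀) ^ a * Subring.inclusion h.le (u (i₀ + 1)) ^ r =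
      Finset.univ.prod fun i => u' i ^ N i := by
    rw [prod_univ_fin_two_cornerStepState i₀]
    simp only [hNx, hNy, hφx, hφy]
    ring
  have hmaxT : maximalIdeal T =
      Ideal.span {aT (chartIncl (K := K) (u (i₀ + 1)) (u i₀) (u (i₀ + 1))), aT sA} := by
    rw [← IsLocalization.AtPrime.map_eq_maximalIdeal Q T, ← Set.image_pair, ← Ideal.map_span,
      ← hQeq]
  refine ⟨u', N, H', ?_, ?_, hH'fin, hH'len⟩
  · rw [range_eq_pair_cornerStepState u' i₀, hu'x, hu'y, hmaxT, Ideal.span_pair_comm]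
  · rw [hC, hCxy, Ideal.map_mul, Ideal.map_span, Set.image_singleton, map_pow, hD1map',
      ← mul_assoc, Ideal.span_singleton_mul_span_singleton, hgen]

end Summit.ResolutionOfSingularities.ResolutionOfSingularities.Theorems.PfaffLine

end
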